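import Literature.NumberTheory.Transcendental.LineValues
import HarnessLib

/-!
# The Liouville step of Baker's method on `M_κ`

Topic: `Literature/NumberTheory/Transcendental`. Plan item W4/S5(e2–e3) of the unit
`provefact-Literature.NumberTheory.Transcendental.H-b596640137`. The normalised line jets of
the auxiliary form at a point `s·v` along a grid direction `x_c = ∑ c_m x_m` are
`Θ_{J₀}(s·v)^D · emb(p_{s,k}(c))` with `p_{s,k}(c) ∈ K` (`LineValues.lean`). PROVED here:

* `BakerData.intZ_lineVal` — `d_s^{E(D,k)} · p_{s,k}(c)` is an algebraic integer
  (`SiegelEntries.entryVal_bounds`);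
* `BakerData.houseXi`, `BakerData.lineValBound`, `BakerData.norm_embedding_lineVal_le` — all
  conjugates of `p_{s,k}(c)` (`c_m ≤ k`) are at most
  `dd^k · k^k · #unknowns · H_ξ · (Dhdeg + 2k)^k q_B^k h_B^D ((s+1)M^{s+1})^{Dhdeg+2k}`;
* `BakerData.lineVal_eq_zero_of_norm_lt` — **Liouville**: if
  `|emb(p_{s,k}(c))| · |d_s|^{E·h} · bound^{h-1} < 1` then `p_{s,k}(c) = 0`
  (`AlgGens.one_le_norm_mul_house_pow`).

## References

* A. Baker, G. Wüstholz, *Logarithmic Forms and Diophantine Geometry*, CUP 2007, §6.8 (p. 119).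
* A. Baker, *Transcendental Number Theory*, CUP 1975, Ch. 2, Lemma 5 (the size comparison).
-/

noncomputable section

open Complex MvPolynomial Finset NumberField
open scoped PeriodPair

namespace Literature.NumberTheory.Transcendental

namespace GaGmE

namespace Std

namespace BakerData

variable {β γ δ : Type} [Fintype β] [Fintype γ] [Fintype δ] [DecidableEq γ]
variable [DecidableEq β] [DecidableEq δ] (B : BakerData β γ δ)

/-! ### Integrality -/

/-- **`d_s^{E(D,k)} · p_{s,k}(c) ∈ 𝓞 K`** (`D = nD'`). [folklore] -/
theorem intZ_lineVal {D' : ℕ} (ξ : UIdx β γ δ D' → 𝓞 B.K) (s k : ℕ) (cg : Fin B.dd → ℕ) :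
    B.IntZ ((B.dAt s : B.K) ^ B.expE (Fintype.card (β ⊕ (γ ⊕ δ)) * D') k *
      MvPolynomial.eval (fun m => (cg m : B.K)) (B.lineValPoly ξ s k)) := by
  show IsIntegral ℤ _
  rw [lineValPoly, map_sum, Finset.mul_sum]
  refine IsIntegral.sum _ fun ω _ => ?_
  rw [MvPolynomial.eval_monomial, ← mul_assoc]
  refine IsIntegral.mul ?_ ?_
  · rw [Finset.mul_sum]
    refine IsIntegral.sum _ fun u _ => ?_
    rw [mul_left_comm]
    exact IsIntegral.mul (ξ u).2 (B.entryVal_bounds B.emb s ω (degree_νOf_le u)).2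
  · rw [Finsupp.prod_fintype _ _ (fun m => by simp)]
    refine IsIntegral.prod _ fun m _ => IsIntegral.pow ?_ _
    exact_mod_cast isIntegral_algebraMap (R := ℤ) (A := B.K) (x := (cg m : ℤ))

/-! ### Sizes of the conjugates -/

/-- A common bound for the houses of the coefficients `ξ_u`: `H_ξ = 1 + ∑_u house(ξ_u)`.
[folklore] -/
def houseXi {D' : ℕ} (ξ : UIdx β γ δ D' → 𝓞 B.K) : ℝ := 1 + ∑ u, house ((ξ u : 𝓞 B.K) : B.K)

/-- `1 ≤ H_ξ`. [folklore] -/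
theorem one_le_houseXi {D' : ℕ} (ξ : UIdx β γ δ D' → 𝓞 B.K) : 1 ≤ B.houseXi ξ := by
  have : 0 ≤ ∑ u, house ((ξ u : 𝓞 B.K) : B.K) := Finset.sum_nonneg fun u _ => house_nonneg _
  unfold houseXi; linarith

/-- Every conjugate of every `ξ_u` is at most `H_ξ`. [folklore] -/
theorem norm_embedding_xi_le {D' : ℕ} (ξ : UIdx β γ δ D' → 𝓞 B.K) (σ : B.K →+* ℂ) (u : UIdx β γ δ D') :
    ‖σ ((ξ u : 𝓞 B.K) : B.K)‖ ≤ B.houseXi ξ := by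
  refine (norm_embedding_le_house _ σ).trans ?_
  have h1 : house ((ξ u : 𝓞 B.K) : B.K) ≤ ∑ u', house ((ξ u' : 𝓞 B.K) : B.K) :=
    Finset.single_le_sum (f := fun u' => house ((ξ u' : 𝓞 B.K) : B.K)) (fun _ _ => house_nonneg _)
      (Finset.mem_univ u)
  unfold houseXi; linarith

/-- The bound for the conjugates of `p_{s,k}(c)`. [folklore] -/
def lineValBound {D' : ℕ} (ξ : UIdx β γ δ D' → 𝓞 B.K) (s k : ℕ) : ℝ :=
  (B.dd : ℝ) ^ k * (k : ℝ) ^ k * (Fintype.card (UIdx β γ δ D') : ℝ) * B.houseXi ξ *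
    ((((Fintype.card (β ⊕ (γ ⊕ δ)) * D' * B.hdeg : ℕ) : ℝ) + 2 * k) ^ k * B.qB ^ k *
      B.hB ^ (Fintype.card (β ⊕ (γ ⊕ δ)) * D') *
        ((s + 1) * B.M ^ (s + 1)) ^ (Fintype.card (β ⊕ (γ ⊕ δ)) * D' * B.hdeg + 2 * k))

/-- `0 ≤ lineValBound`. [folklore] -/
theorem lineValBound_nonneg {D' : ℕ} (ξ : UIdx β γ δ D' → 𝓞 B.K) (s k : ℕ) : 0 ≤ B.lineValBound ξ s k := by
  unfold lineValBound
  have := B.one_le_houseXi ξ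
  have := B.qB_nonneg
  have := B.one_le_hB
  have := B.gens.one_le_M
  positivity

/-- **All conjugates of `p_{s,k}(c)` are at most `lineValBound`** (for `c_m ≤ k`).
[cite: BakerWustholz2007, §6.8 (p. 119)] -/
theorem norm_embedding_lineVal_le {D' : ℕ} (ξ : UIdx β γ δ D' → 𝓞 B.K) (s k : ℕ) {cg : Fin B.dd → ℕ}
    (hcg : ∀ m, cg m ≤ k) (σ : B.K →+* ℂ) :
    ‖σ (MvPolynomial.eval (fun m => (cg m : B.K)) (B.lineValPoly ξ s k))‖ ≤ B.lineValBound ξ s k := by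
  set n := Fintype.card (β ⊕ (γ ⊕ δ)) with hn
  set D := n * D' with hD
  -- the entry bound
  set Eb : ℝ := ((((D * B.hdeg : ℕ) : ℝ) + 2 * k) ^ k * B.qB ^ k * B.hB ^ D *
    ((s + 1) * B.M ^ (s + 1)) ^ (D * B.hdeg + 2 * k)) with hEb
  have hEb0 : 0 ≤ Eb := by
    have := B.qB_nonneg; have := B.one_le_hB; have := B.gens.one_le_M
    positivity
  have hHξ := B.one_le_houseXi ξ
  -- one word
  have hword : ∀ ω : Fin k → Fin B.dd,
      ‖σ (MvPolynomial.eval (fun m => (cg m : B.K)) (monomial (B.contentFs ω)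
        (∑ u, (ξ u : B.K) * B.entryVal s ω D (νOf u))))‖ ≤
        (k : ℝ) ^ k * ((Fintype.card (UIdx β γ δ D') : ℝ) * (B.houseXi ξ * Eb)) := by
    intro ω
    rw [MvPolynomial.eval_monomial, map_mul, norm_mul, mul_comm]
    refine mul_le_mul ?_ ?_ (norm_nonneg _) (by positivity)
    · -- `∏_m c_m^{content} = ∏_t c_{ω t} ≤ k^k`
      rw [Finsupp.prod_fintype _ _ (fun m => by simp), map_prod, norm_prod]
      simp only [contentFs_apply, map_pow, map_natCast, norm_pow, Complex.norm_natCast]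
      rw [← PolyODE.prod_word_eq_prod_pow_content (fun m => (cg m : ℝ)) ω]
      calc ∏ t, (cg (ω t) : ℝ) ≤ ∏ _t : Fin k, (k : ℝ) :=
            Finset.prod_le_prod (fun t _ => Nat.cast_nonneg _) fun t _ => by exact_mod_cast hcg (ω t)
        _ = (k : ℝ) ^ k := by simp
    · rw [map_sum]
      refine (norm_sum_le _ _).trans ?_
      refine (Finset.sum_le_sum fun u _ => ?_).trans (by rw [Finset.sum_const, nsmul_eq_mul, Finset.card_univ])
      rw [map_mul, norm_mul]
      exact mul_le_mul (B.norm_embedding_xi_le ξ σ u) (B.entryVal_bounds σ s ω (degree_νOf_le u)).1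
        (norm_nonneg _) (zero_le_one.trans hHξ)
  rw [lineValPoly, map_sum, map_sum]
  refine (norm_sum_le _ _).trans ?_
  refine (Finset.sum_le_sum fun ω _ => hword ω).trans ?_
  rw [Finset.sum_const, nsmul_eq_mul, Finset.card_univ, Fintype.card_fun, Fintype.card_fin, Fintype.card_fin]
  unfold lineValBound
  rw [← hn, ← hD, ← hEb]
  push_cast
  have : (0 : ℝ) ≤ (B.dd : ℝ) ^ k := by positivity
  nlinarith [hEb0, hHξ, this]

/-! ### The Liouville inequality -/

/-- **Liouville step.** If `p_{s,k}(c) ≠ 0` then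
`1 ≤ |emb(p_{s,k}(c))| · |d_s|^{E} · (|d_s|^{E} · lineValBound)^{h-1}`; contrapositively, a
smaller value forces `p_{s,k}(c) = 0`. [cite: Baker1975, Ch. 2 Lemma 5] -/
theorem one_le_of_lineVal_ne_zero {D' : ℕ} (ξ : UIdx β γ δ D' → 𝓞 B.K) (s k : ℕ) {cg : Fin B.dd → ℕ}
    (hcg : ∀ m, cg m ≤ k) (hne : MvPolynomial.eval (fun m => (cg m : B.K)) (B.lineValPoly ξ s k) ≠ 0) :
    1 ≤ ‖B.emb (MvPolynomial.eval (fun m => (cg m : B.K)) (B.lineValPoly ξ s k))‖ *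
      |(B.dAt s : ℝ)| ^ B.expE (Fintype.card (β ⊕ (γ ⊕ δ)) * D') k *
        (|(B.dAt s : ℝ)| ^ B.expE (Fintype.card (β ⊕ (γ ⊕ δ)) * D') k * B.lineValBound ξ s k) ^ (B.gens.h - 1) := by
  set E := B.expE (Fintype.card (β ⊕ (γ ⊕ δ)) * D') k with hE
  set p := MvPolynomial.eval (fun m => (cg m : B.K)) (B.lineValPoly ξ s k) with hp
  set y : B.K := (B.dAt s : B.K) ^ E * p with hy
  have hyint : IsIntegral ℤ y := B.intZ_lineVal ξ s k cg
  let x : 𝓞 B.K := ⟨y, hyint⟩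
  have hx : x ≠ 0 := by
    intro h
    have : y = 0 := by simpa [x] using congrArg (fun z : 𝓞 B.K => (z : B.K)) h
    rw [hy] at this
    exact hne ((mul_eq_zero.mp this).resolve_left (pow_ne_zero _ (B.dAt_ne_zero s)))
  have hL := B.gens.one_le_norm_mul_house_pow hx
  -- `‖y‖ = |d_s|^E ‖emb p‖`, `house y ≤ |d_s|^E · bound`
  have hnormy : ‖((x : B.K) : ℂ)‖ = |(B.dAt s : ℝ)| ^ E * ‖B.emb p‖ := by
    show ‖(y : ℂ)‖ = _
    have : (y : ℂ) = B.emb y := rfl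
    rw [this, hy, map_mul, map_pow, norm_mul, norm_pow, map_intCast, Complex.norm_intCast]
  have hhouse : house (x : B.K) ≤ |(B.dAt s : ℝ)| ^ E * B.lineValBound ξ s k := by
    refine B.gens.house_le_of_forall_norm_le (by have := B.lineValBound_nonneg ξ s k; positivity) fun σ => ?_
    show ‖σ y‖ ≤ _
    rw [hy, map_mul, map_pow, norm_mul, norm_pow, map_intCast, Complex.norm_intCast]
    exact mul_le_mul_of_nonneg_left (B.norm_embedding_lineVal_le ξ s k hcg σ) (by positivity)
  calc (1 : ℝ) ≤ ‖((x : B.K) : ℂ)‖ * house (x : B.K) ^ (B.gens.h - 1) := hL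
    _ ≤ (|(B.dAt s : ℝ)| ^ E * ‖B.emb p‖) * (|(B.dAt s : ℝ)| ^ E * B.lineValBound ξ s k) ^ (B.gens.h - 1) := by
        rw [hnormy]
        exact mul_le_mul_of_nonneg_left (pow_le_pow_left₀ (house_nonneg _) hhouse _) (by positivity)
    _ = _ := by ring

/-- **Liouville, contrapositive form.** [cite: Baker1975, Ch. 2 Lemma 5] -/
theorem lineVal_eq_zero_of_norm_lt {D' : ℕ} (ξ : UIdx β γ δ D' → 𝓞 B.K) (s k : ℕ) {cg : Fin B.dd → ℕ}
    (hcg : ∀ m, cg m ≤ k)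
    (hlt : ‖B.emb (MvPolynomial.eval (fun m => (cg m : B.K)) (B.lineValPoly ξ s k))‖ *
      |(B.dAt s : ℝ)| ^ B.expE (Fintype.card (β ⊕ (γ ⊕ δ)) * D') k *
        (|(B.dAt s : ℝ)| ^ B.expE (Fintype.card (β ⊕ (γ ⊕ δ)) * D') k * B.lineValBound ξ s k) ^ (B.gens.h - 1) < 1) :
    MvPolynomial.eval (fun m => (cg m : B.K)) (B.lineValPoly ξ s k) = 0 := by
  by_contra hne
  exact absurd (B.one_le_of_lineVal_ne_zero ξ s k hcg hne) (not_le.mpr hlt)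

end BakerData

end Std

end GaGmE

end Literature.NumberTheory.Transcendental

end
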